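import Literature.Dynamics.SymbolicDynamics.DistortionOperator
import Mathlib.Tactic.Positivity
import Mathlib.Tactic.Abel
import HarnessLib

/-!
# The distortion layer depends only on its set of `↓`-cells

Tools for building configurations of the distortion subshift `d_A(Y)`
(`DistortionOperator.lean`) by surgery on the `↓`-layer, used in the gluing construction of
Gangloff–Sablik's Theorem 26 (`GangloffSablik2021_aperiodic`):

* **skeleton invariance** — the rules `IsDelta`, the curve-following permutations
  `succPerm`/`nxtPerm`, the base cell and the curve points `curvePt` only depend on the SET of
  `↓`-cells (`IsDelta.transfer`, `succPerm_zpow_transfer`, `nxtPerm_zpow_transfer`,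
  `curvePt_transfer`), so symbols may be (re)assigned freely along the curves;
* **the rules as conditions on a set** `N ⊆ ℤ²` of `↓`-cells (`IsDeltaSet`, `isDeltaSet_iff`,
  the skeleton configuration `skel N : ℤ² → Option Unit`), and the closure properties used by
  the surgery: translation (`IsDeltaSet.add`), union of two admissible sets no cell of one
  directly above a cell of the other (`IsDeltaSet.union`), horizontal lines (`isDeltaSet_line`),
  and the **shear** along a window of columns in which all chains are level
  (`IsDeltaSet.shear`): raising everything to the right of column `a + H` by `H` and the
  window `[a, a+H]` diagonally turns level chains into chains climbing the window.

## References

* S. Gangloff, M. Sablik, *Quantified block gluing for multidimensional subshifts of finite type: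
  aperiodicity and entropy*, J. Anal. Math. 144 (2021), §5.4 (arXiv:1706.01627): proofs of
  Props. 31–32 ("completing the curves", "straight"/"shifted" continuations).
-/

namespace Literature.Dynamics.SymbolicDynamics.Distortion

variable {A B : Type*}

/-! ### Skeleton invariance -/

section Transfer

variable {z : ℤ × ℤ → Option A} {z' : ℤ × ℤ → Option B}
  (hN : ∀ c : ℤ × ℤ, z c = none ↔ z' c = none)
include hN

/-- [folklore] -/
theorem ne_none_transfer {c : ℤ × ℤ} : z c ≠ none ↔ z' c ≠ none :=
  not_congr (hN c)

/-- The rules only see the `↓`-set. [cite: GangloffSablik2021, §5.4.1 (arXiv numbering)] -/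
theorem IsDelta.transfer (hz : IsDelta z) : IsDelta z' where
  below_ne_none i j h := (ne_none_transfer hN).mp (hz.below_ne_none i j ((hN _).mpr h))
  left_rule i j h1 h2 := (hN _).mp (hz.left_rule i j ((hN _).mpr h1) ((ne_none_transfer hN).mpr h2))
  right_rule i j h1 h2 :=
    (hN _).mp (hz.right_rule i j ((hN _).mpr h1) ((ne_none_transfer hN).mpr h2))

/-- Transport of `→`-cells along equal `↓`-sets. [folklore] -/
def castRC (c : RC z) : RC z' :=
  ⟨c.1, (ne_none_transfer hN).mp c.2⟩

/-- [folklore] -/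
@[simp] theorem castRC_val (c : RC z) : (castRC hN c).1 = c.1 := rfl

/-- [cite: GangloffSablik2021, §5.4.1 (arXiv numbering)] -/
theorem succFun_transfer (hz : IsDelta z) (hz' : IsDelta z') (c : RC z) :
    succFun hz' (castRC hN c) = castRC hN (succFun hz c) := by
  apply Subtype.ext
  show (succFun hz' (castRC hN c)).1 = (succFun hz c).1
  by_cases h : z (c.1.1 + 1, c.1.2) = none
  · rw [succFun_val_of_eq_none hz c h, succFun_val_of_eq_none hz' _ (by simpa using (hN _).mp h)]
    rfl
  · rw [succFun_val_of_ne_none hz c h,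
      succFun_val_of_ne_none hz' _ (by simpa using (ne_none_transfer hN).mp h)]
    rfl

/-- [cite: GangloffSablik2021, §5.4.1 (arXiv numbering)] -/
theorem nxtFun_transfer (hz : IsDelta z) (hz' : IsDelta z') (c : RC z) :
    nxtFun hz' (castRC hN c) = castRC hN (nxtFun hz c) := by
  apply Subtype.ext
  show (nxtFun hz' (castRC hN c)).1 = (nxtFun hz c).1
  by_cases h : z (c.1.1, c.1.2 + 1) = none
  · rw [nxtFun_val_of_eq_none hz c h, nxtFun_val_of_eq_none hz' _ (by simpa using (hN _).mp h)]
    rfl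
  · rw [nxtFun_val_of_ne_none hz c h,
      nxtFun_val_of_ne_none hz' _ (by simpa using (ne_none_transfer hN).mp h)]
    rfl

/-- [cite: GangloffSablik2021, §5.4.1 (arXiv numbering)] -/
theorem succPerm_transfer (hz : IsDelta z) (hz' : IsDelta z') (c : RC z) :
    succPerm hz' (castRC hN c) = castRC hN (succPerm hz c) :=
  succFun_transfer hN hz hz' c

/-- [cite: GangloffSablik2021, §5.4.1 (arXiv numbering)] -/
theorem succPerm_symm_transfer (hz : IsDelta z) (hz' : IsDelta z') (c : RC z) :
    (succPerm hz').symm (castRC hN c) = castRC hN ((succPerm hz).symm c) := by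
  rw [Equiv.symm_apply_eq, succPerm_transfer hN hz hz', Equiv.apply_symm_apply]

/-- [cite: GangloffSablik2021, §5.4.1 (arXiv numbering)] -/
theorem nxtPerm_transfer (hz : IsDelta z) (hz' : IsDelta z') (c : RC z) :
    nxtPerm hz' (castRC hN c) = castRC hN (nxtPerm hz c) :=
  nxtFun_transfer hN hz hz' c

/-- [cite: GangloffSablik2021, §5.4.1 (arXiv numbering)] -/
theorem nxtPerm_symm_transfer (hz : IsDelta z) (hz' : IsDelta z') (c : RC z) :
    (nxtPerm hz').symm (castRC hN c) = castRC hN ((nxtPerm hz).symm c) := by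
  rw [Equiv.symm_apply_eq, nxtPerm_transfer hN hz hz', Equiv.apply_symm_apply]

/-- Following curves only sees the `↓`-set. [cite: GangloffSablik2021, §5.4.1 (arXiv numbering)] -/
theorem succPerm_zpow_transfer (hz : IsDelta z) (hz' : IsDelta z') (m : ℤ) (c : RC z) :
    (succPerm hz' ^ m) (castRC hN c) = castRC hN ((succPerm hz ^ m) c) := by
  induction m using Int.induction_on generalizing c with
  | zero => simp
  | succ m ih =>
    rw [zpow_add_one, zpow_add_one, Equiv.Perm.mul_apply, Equiv.Perm.mul_apply,
      succPerm_transfer hN hz hz', ih]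
  | pred m ih =>
    rw [zpow_sub_one, zpow_sub_one, Equiv.Perm.mul_apply, Equiv.Perm.mul_apply, Equiv.Perm.inv_def,
      Equiv.Perm.inv_def, succPerm_symm_transfer hN hz hz', ih]

/-- Passing between curves only sees the `↓`-set. [cite: GangloffSablik2021, §5.4.1 (arXiv numbering)] -/
theorem nxtPerm_zpow_transfer (hz : IsDelta z) (hz' : IsDelta z') (m : ℤ) (c : RC z) :
    (nxtPerm hz' ^ m) (castRC hN c) = castRC hN ((nxtPerm hz ^ m) c) := by
  induction m using Int.induction_on generalizing c with
  | zero => simp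
  | succ m ih =>
    rw [zpow_add_one, zpow_add_one, Equiv.Perm.mul_apply, Equiv.Perm.mul_apply,
      nxtPerm_transfer hN hz hz', ih]
  | pred m ih =>
    rw [zpow_sub_one, zpow_sub_one, Equiv.Perm.mul_apply, Equiv.Perm.mul_apply, Equiv.Perm.inv_def,
      Equiv.Perm.inv_def, nxtPerm_symm_transfer hN hz hz', ih]

/-- The base cell only sees the `↓`-set. [cite: GangloffSablik2021, §5.4.1 (arXiv numbering)] -/
theorem base_transfer (hz : IsDelta z) (hz' : IsDelta z') : base hz' = castRC hN (base hz) := by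
  apply Subtype.ext
  unfold base
  by_cases h : z (0, 0) = none
  · rw [dif_pos h, dif_pos ((hN _).mp h)]
    rfl
  · rw [dif_neg h, dif_neg (fun h' => h ((hN _).mpr h'))]
    rfl

/-- **The curve points only see the `↓`-set.** [cite: GangloffSablik2021, §5.4.1 (arXiv numbering)] -/
theorem curvePt_transfer (hz : IsDelta z) (hz' : IsDelta z') (i k : ℤ) :
    curvePt hz' i k = castRC hN (curvePt hz i k) := by
  unfold curvePt
  rw [base_transfer hN hz hz', nxtPerm_zpow_transfer hN hz hz', succPerm_zpow_transfer hN hz hz']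

end Transfer

/-! ### The rules as conditions on the set of `↓`-cells -/

/-- **The rules of the distortion layer for a set `N` of `↓`-cells**: no cell of `N` directly
above another; `(i+1, j) ∈ N`, `(i, j) ∉ N` force `(i, j-1) ∈ N`; `(i, j) ∈ N`, `(i+1, j) ∉ N`
force `(i+1, j+1) ∈ N`. [cite: GangloffSablik2021, §5.4.1 (arXiv numbering)] -/
structure IsDeltaSet (N : Set (ℤ × ℤ)) : Prop where
  /-- below a `↓` there is no `↓` -/
  below : ∀ i j : ℤ, (i, j) ∈ N → (i, j - 1) ∉ N
  /-- `[→ ↓ / → →]` is forbidden -/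
  left : ∀ i j : ℤ, (i + 1, j) ∈ N → (i, j) ∉ N → (i, j - 1) ∈ N
  /-- `[→ → / ↓ →]` is forbidden -/
  right : ∀ i j : ℤ, (i, j) ∈ N → (i + 1, j) ∉ N → (i + 1, j + 1) ∈ N

/-- The `↓`-set of a configuration. [folklore] -/
def noneSet (z : ℤ × ℤ → Option A) : Set (ℤ × ℤ) :=
  {c | z c = none}

/-- [folklore] -/
@[simp] theorem mem_noneSet {z : ℤ × ℤ → Option A} {c : ℤ × ℤ} : c ∈ noneSet z ↔ z c = none :=
  Iff.rfl

/-- [cite: GangloffSablik2021, §5.4.1 (arXiv numbering)] -/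
theorem isDelta_iff_isDeltaSet {z : ℤ × ℤ → Option A} : IsDelta z ↔ IsDeltaSet (noneSet z) := by
  constructor
  · intro hz
    exact ⟨fun i j h => hz.below_ne_none i j h, fun i j h1 h2 => hz.left_rule i j h1 h2,
      fun i j h1 h2 => hz.right_rule i j h1 h2⟩
  · intro hN
    exact ⟨fun i j h => hN.below i j h, fun i j h1 h2 => hN.left i j h1 h2,
      fun i j h1 h2 => hN.right i j h1 h2⟩

open Classical in
/-- **The skeleton configuration** of a set of `↓`-cells (symbols forgotten). [folklore] -/
noncomputable def skel (N : Set (ℤ × ℤ)) : ℤ × ℤ → Option Unit :=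
  fun c => if c ∈ N then none else some ()

/-- [folklore] -/
theorem skel_eq_none_iff {N : Set (ℤ × ℤ)} {c : ℤ × ℤ} : skel N c = none ↔ c ∈ N := by
  unfold skel
  split_ifs with h <;> simp [h]

/-- [folklore] -/
@[simp] theorem noneSet_skel (N : Set (ℤ × ℤ)) : noneSet (skel N) = N := by
  ext c
  exact skel_eq_none_iff

/-- [cite: GangloffSablik2021, §5.4.1 (arXiv numbering)] -/
theorem isDelta_skel_iff {N : Set (ℤ × ℤ)} : IsDelta (skel N) ↔ IsDeltaSet N := by
  rw [isDelta_iff_isDeltaSet, noneSet_skel]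

/-- A configuration and the skeleton of its `↓`-set have the same `↓`-cells. [folklore] -/
theorem skel_noneSet_transfer (z : ℤ × ℤ → Option A) (c : ℤ × ℤ) :
    z c = none ↔ skel (noneSet z) c = none := by
  rw [skel_eq_none_iff, mem_noneSet]

/-! ### Closure properties -/

namespace IsDeltaSet

variable {N N' : Set (ℤ × ℤ)}

/-- Translation. [folklore] -/
theorem add (hN : IsDeltaSet N) (v : ℤ × ℤ) : IsDeltaSet ((fun c => v + c) '' N) := by
  have key : ∀ c : ℤ × ℤ, c ∈ (fun c => v + c) '' N ↔ c - v ∈ N := by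
    intro c
    constructor
    · rintro ⟨d, hd, rfl⟩
      simpa using hd
    · intro h
      exact ⟨c - v, h, by abel⟩
  obtain ⟨v1, v2⟩ := v
  refine ⟨fun i j h h' => ?_, fun i j h1 h2 => ?_, fun i j h1 h2 => ?_⟩
  · rw [key] at h h'
    simp only [Prod.mk_sub_mk] at h h'
    exact hN.below (i - v1) (j - v2) h (by rwa [show j - v2 - 1 = j - 1 - v2 by ring])
  · rw [key] at h1 h2 ⊢
    simp only [Prod.mk_sub_mk] at h1 h2 ⊢
    have := hN.left (i - v1) (j - v2) (by rwa [show i - v1 + 1 = i + 1 - v1 by ring]) h2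
    rwa [show j - v2 - 1 = j - 1 - v2 by ring] at this
  · rw [key] at h1 h2 ⊢
    simp only [Prod.mk_sub_mk] at h1 h2 ⊢
    have := hN.right (i - v1) (j - v2) h1 (by rwa [show i - v1 + 1 = i + 1 - v1 by ring])
    rwa [show i - v1 + 1 = i + 1 - v1 by ring, show j - v2 + 1 = j + 1 - v2 by ring] at this

/-- **Union**: two admissible `↓`-sets with no cell of one directly above a cell of the other
unite to an admissible `↓`-set (the side rules are already satisfied inside each).
[cite: GangloffSablik2021, §5.4.2 (arXiv numbering), proof of Prop. 31] -/
theorem union (hN : IsDeltaSet N) (hN' : IsDeltaSet N')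
    (h1 : ∀ i j : ℤ, (i, j) ∈ N → (i, j - 1) ∉ N') (h2 : ∀ i j : ℤ, (i, j) ∈ N' → (i, j - 1) ∉ N) :
    IsDeltaSet (N ∪ N') := by
  refine ⟨fun i j h h' => ?_, fun i j ha hb => ?_, fun i j ha hb => ?_⟩
  · rcases h with h | h <;> rcases h' with h' | h'
    · exact hN.below i j h h'
    · exact h1 i j h h'
    · exact h2 i j h h'
    · exact hN'.below i j h h'
  · simp only [Set.mem_union, not_or] at hb ⊢
    rcases ha with ha | ha
    · exact Or.inl (hN.left i j ha hb.1)
    · exact Or.inr (hN'.left i j ha hb.2)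
  · simp only [Set.mem_union, not_or] at hb ⊢
    rcases ha with ha | ha
    · exact Or.inl (hN.right i j ha hb.1)
    · exact Or.inr (hN'.right i j ha hb.2)

/-- The empty `↓`-set. [folklore] -/
theorem empty : IsDeltaSet (∅ : Set (ℤ × ℤ)) :=
  ⟨fun _ _ h => h.elim, fun _ _ h => h.elim, fun _ _ h => h.elim⟩

end IsDeltaSet

/-- **A horizontal line of `↓`** is an admissible chain. [cite: GangloffSablik2021, §5.4.2 (arXiv numbering), proof of Prop. 31 ("straight")] -/
theorem isDeltaSet_line (h : ℤ) : IsDeltaSet {c : ℤ × ℤ | c.2 = h} := by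
  refine ⟨fun i j h1 h2 => ?_, fun i j h1 h2 => ?_, fun i j h1 h2 => ?_⟩
  · simp only [Set.mem_setOf_eq] at h1 h2
    omega
  · simp only [Set.mem_setOf_eq] at h1 h2
    exact absurd h1 h2
  · simp only [Set.mem_setOf_eq] at h1 h2
    exact absurd h1 h2

/-! ### The shear -/

/-- Height of the shear at column `t`: `0` left of column `a`, `t - a` in the window
`[a, a + H]`, `H` to the right. [folklore] -/
def shearHt (a : ℤ) (H : ℕ) (t : ℤ) : ℤ :=
  max 0 (min (t - a) H)

/-- [folklore] -/
theorem shearHt_of_le {a : ℤ} {H : ℕ} {t : ℤ} (h : t ≤ a) : shearHt a H t = 0 := by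
  unfold shearHt
  have : min (t - a) (H : ℤ) ≤ 0 := le_trans (min_le_left _ _) (by linarith)
  exact max_eq_left this

/-- [folklore] -/
theorem shearHt_of_ge {a : ℤ} {H : ℕ} {t : ℤ} (h : a + H ≤ t) : shearHt a H t = H := by
  unfold shearHt
  rw [min_eq_right (by linarith), max_eq_right (by positivity)]

/-- [folklore] -/
theorem shearHt_of_mem {a : ℤ} {H : ℕ} {t : ℤ} (h1 : a ≤ t) (h2 : t ≤ a + H) :
    shearHt a H t = t - a := by
  unfold shearHt
  rw [min_eq_left (by linarith), max_eq_right (by linarith)]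

/-- One column to the right the shear height stays (outside the window) or grows by one (inside).
[folklore] -/
theorem shearHt_succ (a : ℤ) (H : ℕ) (t : ℤ) :
    (shearHt a H (t + 1) = shearHt a H t ∧ (t < a ∨ a + H ≤ t)) ∨
      (shearHt a H (t + 1) = shearHt a H t + 1 ∧ a ≤ t ∧ t < a + H) := by
  by_cases h1 : t < a
  · left
    exact ⟨by rw [shearHt_of_le (by linarith), shearHt_of_le h1.le], Or.inl h1⟩
  by_cases h2 : a + H ≤ t
  · left
    exact ⟨by rw [shearHt_of_ge (by linarith), shearHt_of_ge h2], Or.inr h2⟩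
  · right
    have h1' := not_lt.mp h1
    have h2' := not_le.mp h2
    refine ⟨?_, h1', h2'⟩
    rw [shearHt_of_mem (by linarith) (by linarith), shearHt_of_mem h1' h2'.le]
    ring

/-- **The sheared `↓`-set**: every column `t` is raised by `shearHt a H t`. [folklore] -/
def shear (a : ℤ) (H : ℕ) (N : Set (ℤ × ℤ)) : Set (ℤ × ℤ) :=
  {c | (c.1, c.2 - shearHt a H c.1) ∈ N}

/-- [folklore] -/
@[simp] theorem mem_shear {a : ℤ} {H : ℕ} {N : Set (ℤ × ℤ)} {c : ℤ × ℤ} :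
    c ∈ shear a H N ↔ (c.1, c.2 - shearHt a H c.1) ∈ N :=
  Iff.rfl

/-- **Shearing along a window of level chains preserves admissibility**: if in each column step
`t → t+1` of the window the `↓`-cells of `N` are level (`(t, j) ∈ N ↔ (t+1, j) ∈ N`), then the
sheared set — the chains climb the window diagonally and continue `H` rows higher — again obeys
the rules. [cite: GangloffSablik2021, §5.4.2 (arXiv numbering), proof of Prop. 32 ("shifted downwards/upwards" continuation)] -/
theorem IsDeltaSet.shear {N : Set (ℤ × ℤ)} (hN : IsDeltaSet N) (a : ℤ) (H : ℕ)
    (hlev : ∀ t j : ℤ, a ≤ t → t < a + H → ((t, j) ∈ N ↔ (t + 1, j) ∈ N)) :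
    IsDeltaSet (shear a H N) := by
  refine ⟨fun i j h h' => ?_, fun i j h1 h2 => ?_, fun i j h1 h2 => ?_⟩
  · simp only [mem_shear] at h h'
    exact hN.below i _ h (by rwa [show j - shearHt a H i - 1 = j - 1 - shearHt a H i by ring])
  · simp only [mem_shear] at h1 h2 ⊢
    rcases shearHt_succ a H i with ⟨he, -⟩ | ⟨he, ha1, ha2⟩
    · rw [he] at h1
      have := hN.left i _ h1 h2
      rwa [show j - shearHt a H i - 1 = j - 1 - shearHt a H i by ring] at this
    · -- inside the window: the chain through `(i+1, j)` is level in `N`, so its cell in column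
      -- `i` is one row lower after the shear
      rw [he] at h1
      have := (hlev i (j - (shearHt a H i + 1)) ha1 ha2).mpr h1
      rwa [show j - (shearHt a H i + 1) = j - 1 - shearHt a H i by ring] at this
  · simp only [mem_shear] at h1 h2 ⊢
    rcases shearHt_succ a H i with ⟨he, -⟩ | ⟨he, ha1, ha2⟩
    · rw [he] at h2 ⊢
      have := hN.right i _ h1 h2
      rwa [show j - shearHt a H i + 1 = j + 1 - shearHt a H i by ring] at this
    · rw [he]
      have := (hlev i (j - shearHt a H i) ha1 ha2).mp h1
      rwa [show j - shearHt a H i = j + 1 - (shearHt a H i + 1) by ring] at this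

end Literature.Dynamics.SymbolicDynamics.Distortion
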